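import Summits.KontsevichZagierPeriods.KontsevichZagierPeriods.Theorems.HermiteRigidityReductionRigidityPadeBoxIslandsAllWeights
import Summits.KontsevichZagierPeriods.KontsevichZagierPeriods.Theorems.HermiteRigidityDilogRigidityCubeSeriesLevel
import Literature.NumberTheory.DiophantineApproximation.PolylogLinearIndependence
import Mathlib.Analysis.Complex.ExponentialBounds

/-!
# `ReductionRigidity` (stmt-KontsevichZagierPeriods-3407), line `Sketch`, growth programme
# DilogRigidity, wave 3: THE PADÉ BOX ISLANDS OF EVERY WEIGHT ARE UNCONDITIONAL AT DEEP LEVELS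

Route `KontsevichZagierPeriods/HermiteRigidity`, crux `ReductionRigidity` (lead c5). The every-weight
island theorem `padeBoxKernelGen w ν` / `stub_padeBoxKernelGen w N`
(Theorems/…PadeBoxIslandsAllWeights.lean) is Conjecture 1 of Kontsevich–Zagier in KERNEL FORM on the
sector of all box generators `[□ʲ, ∏ x_l^{a_l}/(N − ∏ x_l)^m]`, `j ≤ w`, CONDITIONAL on the
`ℚ`-rigidity of its `w + 1` normal-form values `Lᵢ = ∫_□ⁱ dx/(N − ∏ x)` (`L₀ = 1/(N−1)`,
`Lᵢ = Liᵢ(1/N)`). The Literature theorem `one_polylog_linearIndependent` (type-I Hermite–Padé forms of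
every weight over the tree's Ball–Rivoal brick machinery, prime number theorem, Stirling, the
`(w−1)`-dimensional two-rate transference) proves that rigidity for `log N ≥ (w+1)³`, so:

* `stub_polylogRigidity` — for `w ≥ 1` and `N ≥ 3^{(w+1)³}`, the normal-form values
  `L₀, …, L_w` are linearly independent over `ℚ`;
* `stub_padeBoxKernelGenUnconditional` — **for every weight `w ≥ 1` and every integer
  `N ≥ 3^{(w+1)³}`, Conjecture 1 in kernel form holds UNCONDITIONALLY on the weight-`≤ w` box sector
  at level `N`**: the Padé box island programme of this crux is a theorem at all deep integer levels.

References: M. Kontsevich, D. Zagier, *Periods* (2001), §1.2 [cite: KontsevichZagier2001, §1.2];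
E. M. Nikišin, Mat. Sb. 109 (1979); S. David, N. Hirata-Kohno, M. Kawashima, Moscow J. Comb. Number
Th. 9 (2020), Thm 2.1 [cite: DavidHirataKohnoKawashima2020, Thm 2.1].
-/

noncomputable section

open MeasureTheory Set

namespace Summit.KontsevichZagierPeriods.HermiteRigidity.ReductionRigidity

open Literature.NumberTheory.Transcendental
open Literature.NumberTheory.Transcendental.KZ
open Literature.NumberTheory.DiophantineApproximation

/-- `N ≥ 3^{(w+1)³}` gives `log N ≥ (w+1)³` (since `log 3 ≥ 1`). [folklore] -/
theorem log_ge_of_three_pow_le {w N : ℕ} (hN : 3 ^ ((w + 1) ^ 3) ≤ N) :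
    ((w : ℝ) + 1) ^ 3 ≤ Real.log N := by
  have h3 : (1 : ℝ) ≤ Real.log 3 := by
    rw [Real.le_log_iff_exp_le (by norm_num)]
    have := Real.exp_one_lt_d9
    linarith
  have hpos : (0 : ℝ) < (3 : ℝ) ^ ((w + 1) ^ 3) := by positivity
  have hN' : ((3 : ℝ) ^ ((w + 1) ^ 3)) ≤ N := by exact_mod_cast hN
  have h1 := Real.log_le_log hpos hN'
  rw [Real.log_pow] at h1
  push_cast at h1
  calc ((w : ℝ) + 1) ^ 3 = ((w : ℝ) + 1) ^ 3 * 1 := (mul_one _).symm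
    _ ≤ ((w : ℝ) + 1) ^ 3 * Real.log 3 := mul_le_mul_of_nonneg_left h3 (by positivity)
    _ ≤ Real.log N := h1

/-- The constant normal-form value as a series: `L₀(1/N) = ∑_{k≥1} N^{-k} = 1/(N−1)`. [folklore] -/
theorem polylogSeries_zero_eq {N : ℕ} (hN : 2 ≤ N) :
    DilogPade.polylogSeries 0 (1 / (N : ℝ)) = 1 / ((N : ℝ) - 1) := by
  have hN' : (2 : ℝ) ≤ N := by exact_mod_cast hN
  have hx0 : (0 : ℝ) ≤ 1 / N := by positivity
  have hx1 : 1 / (N : ℝ) < 1 := by rw [div_lt_one (by linarith)]; linarith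
  rw [DilogPade.polylogSeries]
  simp only [pow_zero, div_one, pow_succ]
  rw [tsum_mul_right, tsum_geometric_of_lt_one hx0 hx1]
  have : (N : ℝ) - 1 ≠ 0 := by linarith
  field_simp

/-- STUB `polylogRigidity` (growth programme DilogRigidity wave 3, line `Sketch`, crux
stmt-KontsevichZagierPeriods-3407): **the inlined rigidity hypothesis of the every-weight island is a
theorem at deep levels** — for `w ≥ 1` and `N ≥ 3^{(w+1)³}` the normal-form values
`Lᵢ = ∫_□ⁱ dx/(N − ∏ x)` (`i ≤ w`) are linearly independent over `ℚ`. The integrals are the series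
`Liᵢ(1/N)` by `stub_cubeIntegralSeriesLevel`, `L₀ = 1/(N−1)` is rational, and
`one_polylog_linearIndependent` (`log N ≥ (w+1)³`) does the rest.
[cite: DavidHirataKohnoKawashima2020, Thm 2.1] -/
theorem stub_polylogRigidity : ∀ (w N : ℕ), 1 ≤ w → 3 ^ ((w + 1) ^ 3) ≤ N → ∀ β : ℕ → ℚ,
    (∑ i ∈ Finset.range (w + 1), (β i : ℝ) * ∫ p in cube i, 1 / ((N : ℝ) - ∏ l, p l)) = 0 →
      ∀ i ∈ Finset.range (w + 1), β i = 0 := by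
  intro w N hw hN β hβ
  have hlog := log_ge_of_three_pow_le hN
  have hN2 : 2 ≤ N := by
    have h1 : 1 ≤ (w + 1) ^ 3 := Nat.one_le_pow _ _ (by omega)
    calc 2 ≤ 3 ^ 1 := by norm_num
      _ ≤ 3 ^ ((w + 1) ^ 3) := Nat.pow_le_pow_right (by norm_num) h1
      _ ≤ N := hN
  have hNr : (2 : ℝ) ≤ N := by exact_mod_cast hN2
  have hN1q : (N : ℚ) - 1 ≠ 0 := by
    have : (2 : ℚ) ≤ N := by exact_mod_cast hN2
    linarith
  -- the integrals are the series
  have hL : ∀ i, (∫ p in cube i, 1 / ((N : ℝ) - ∏ l, p l)) = DilogPade.polylogSeries i (1 / (N : ℝ)) := by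
    intro i
    rw [stub_cubeIntegralSeriesLevel i (N : ℝ) hNr, DilogPade.polylogSeries]
  simp only [hL] at hβ
  -- split off `i = 0` and pass to `Fin`-indexed rational coefficients
  rw [Finset.sum_range_succ', polylogSeries_zero_eq hN2] at hβ
  set a : Fin (w + 1) → ℚ := Fin.cases (β 0 / ((N : ℚ) - 1)) (fun j => β ((j : ℕ) + 1)) with ha
  have hrel : (a 0 : ℝ) + ∑ j : Fin w, (a j.succ : ℝ) *
      DilogPade.polylogSeries ((j : ℕ) + 1) (1 / (N : ℝ)) = 0 := by
    simp only [ha, Fin.cases_zero, Fin.cases_succ]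
    rw [← Finset.sum_range (fun i => (β (i + 1) : ℝ) * DilogPade.polylogSeries (i + 1) (1 / (N : ℝ)))]
    push_cast
    linear_combination hβ
  have h0 := one_polylog_linearIndependent w hw N hlog a hrel
  intro i hi
  have hi' : i < w + 1 := Finset.mem_range.1 hi
  rcases i with _ | i
  · have : a 0 = 0 := by rw [h0]; rfl
    simp only [ha, Fin.cases_zero] at this
    rcases (div_eq_zero_iff).1 this with h | h
    · exact h
    · exact absurd h hN1q
  · have : a ⟨i + 1, hi'⟩ = 0 := by rw [h0]; rfl
    have e : (⟨i + 1, hi'⟩ : Fin (w + 1)) = Fin.succ ⟨i, by omega⟩ := rfl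
    rw [e] at this
    simpa [ha] using this

/-- STUB `padeBoxKernelGenUnconditional` (growth programme DilogRigidity wave 3, line `Sketch`, crux
stmt-KontsevichZagierPeriods-3407): **the Padé box islands of every weight are unconditional at deep
levels** — for every `w ≥ 1` and every integer `N ≥ 3^{(w+1)³}`, Conjecture 1 of Kontsevich–Zagier in
kernel form holds on the sector of all box generators `[□ʲ, ∏ x_l^{a_l}/(N − ∏ x_l)^m]` of dimension
`j ≤ w`: every `ℤ`-combination of value `0` lies in `KZ.relations`, with NO hypothesis
(`stub_padeBoxKernelGen` fed with `stub_polylogRigidity`). [cite: KontsevichZagier2001, §1.2] -/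
theorem stub_padeBoxKernelGenUnconditional : ∀ (w N : ℕ), 1 ≤ w → 3 ^ ((w + 1) ^ 3) ≤ N →
    ∀ c ∈ AddSubgroup.closure
      {c | ∃ (j : ℕ) (r : IntegralRep j) (a : Fin j → ℕ) (m : ℕ), j ≤ w ∧ r.domain = cube j ∧
          EqOn r.integrand (fun p => (∏ l, p l ^ a l) / ((N : ℝ) - ∏ l, p l) ^ m) (cube j) ∧
          c = KZ.of r},
      KZ.eval c = 0 → c ∈ KZ.relations := by
  intro w N hw hN
  have hN2 : 2 ≤ N := by
    have h1 : 1 ≤ (w + 1) ^ 3 := Nat.one_le_pow _ _ (by omega)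
    calc 2 ≤ 3 ^ 1 := by norm_num
      _ ≤ 3 ^ ((w + 1) ^ 3) := Nat.pow_le_pow_right (by norm_num) h1
      _ ≤ N := hN
  exact stub_padeBoxKernelGen w N hN2 (stub_polylogRigidity w N hw hN)

end Summit.KontsevichZagierPeriods.HermiteRigidity.ReductionRigidity

end
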